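import Summits.BirchSwinnertonDyer.BirchSwinnertonDyer.Theses.SignedBaseChange
import Literature.NumberTheory.EllipticCurves.BurungaleSkinnerTianWan2024.GreenbergBDPComparisonSupersingularPRE
import Literature.NumberTheory.EllipticCurves.BurungaleCastellaSkinner2025.BDPMainConjecture
import Literature.NumberTheory.EllipticCurves.SupersingularDensitySerreFrobeniusProofs
import Literature.NumberTheory.EllipticCurves.NonEisensteinPrimeOfSurjective
import Summits.BirchSwinnertonDyer.Rank1Residual.Partition.IrreducibleOverQuadraticField
import HarnessLib

/-!
# Stub S3 `stub_minusIsBDP` of line `bdpline` on the crux `AnticyclotomicEisensteinDivisibility`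
# (stmt-BirchSwinnertonDyer-20727, route SignedBaseChange) — CLOSED MODULO NAMED FACTS: "`G⁻` IS a BDP
# `L`-function" at every good prime `p ≥ 5`, from the refereed comparison at ordinary `p` (Yan–Zhu Prop. 3.14
# = CGS25 Prop. 2.4.5, guarded), the preprint comparison at supersingular `p` (BSTW24 Prop. 6.27 (i), PRE
# binder) and the existence of a BDP frame at every good prime (BCS25 Prop. 4.2.2 / Hsieh Thm. B)

Lead prover sbc-p1 g6 (2026-08-27). The registered stub (skeleton `Cruxes/…/Lines/bdpline.lean`, evidence #3
on the item; text below VERBATIM) asks, for the crux's data (good `p ≥ 5`, `Surj`, Heegner `K` with `p`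
split, (disc), the cyclotomic/anticyclotomic tower) and EVERY Katz/Greenberg frame `(LK, G)` with genuine
period data, for a BDP frame `(Ω_K ≠ 0, Ω_p′, L)` with `(G⁻) = (J₀ L)` along every structure-compatible
`J₀ : ℤ_p^ur → 𝒪_{ℂ_p}`. PROOF: a BDP frame exists at every good prime
(`BurungaleCastellaSkinner2025.prop422_exists_isBDPLFunction_mu_eq_zero`); the comparison is
`YanZhu2026.prop314_span_minus_eq_span_bdp_anyRoot_guarded` when `p ∤ a_p` (`GoodOrd`) and
`BurungaleSkinnerTianWan2024.prop627_span_minus_eq_span_bdp_supersingular_PRE` when `p ∣ a_p`, which at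
`p ≥ 5` of good reduction means `a_p = 0` (`WeierstrassCurve.natCast_dvd_frobeniusTrace_iff_eq_zero`,
Hasse) — the dichotomy the crux's `W.HasGoodReductionAtPrime p` binder hides. So S3 is PRINT-grade
(refereed at ordinary `p`, preprint at supersingular `p`); the three named facts are hypotheses (the
supersingular one a claim-tagged OPEN binder), nothing is asserted; no new definitions.
-/

-- D-0017: single-problem summit, the namespace repeats the problem name by design.
set_option linter.dupNamespace false
set_option autoImplicit false

noncomputable section

namespace Summit.BirchSwinnertonDyer.BirchSwinnertonDyer.Theorems.SignedBaseChangeAcDivMinusIsBDP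

open Summit.BirchSwinnertonDyer.BirchSwinnertonDyer.Theses.SignedBaseChange
open NumberField IsDedekindDomain Field CongruenceSubgroup
  Literature.NumberTheory.EllipticCurves Literature.NumberTheory.EllipticCurves.YanZhu2026
  Literature.NumberTheory.EllipticCurves.BurungaleCastellaSkinner2025
  Literature.NumberTheory.EllipticCurves.BurungaleSkinnerTianWan2024
  Literature.NumberTheory.EllipticCurves.Rank1Residual

/-- **Stub S3 `stub_minusIsBDP` of line `bdpline` (stmt-BirchSwinnertonDyer-20727), its registered text
VERBATIM, modulo three named facts**: Yan–Zhu Prop. 3.14 (guarded; ordinary `p`), BSTW24 Prop. 6.27 (i)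
(PRE binder; supersingular `p`), BCS25 Prop. 4.2.2 (a BDP frame exists). Case split on `p ∣ a_p`, which
at a good `p ≥ 5` is `a_p = 0`. [cite: YanZhu2024MainConjNonCM, Prop. 3.14 (arXiv:2412.20078v4 TeX l.896–903)]
[cite: BurungaleCastellaSkinner2025, Prop. 4.2.2 (§4.2, pp. 8–9 of arXiv:2405.00270v2)]
[claim: BurungaleSkinnerTianWan2024, status: under-review] -/
theorem stub_minusIsBDP_of_facts (h314 : prop314_span_minus_eq_span_bdp_anyRoot_guarded)
    (h627 : prop627_span_minus_eq_span_bdp_supersingular_PRE)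
    (h422e : prop422_exists_isBDPLFunction_mu_eq_zero) :
    SignedTwoVariableInputs → Literature.NumberTheory.EllipticCurves.ModularForms.nonempty_modularParametrizationData → ∀ (W : WeierstrassCurve ℚ) [W.IsElliptic] [W.IsGloballyMinimal] (p : ℕ) [Fact p.Prime], 5 ≤ p → W.HasGoodReductionAtPrime p → Literature.NumberTheory.EllipticCurves.Rank1Residual.Surj W p → ∀ (K : Type) [Field K] [NumberField K] (ι : PadicAlgCl p ≃+* ℂ) (v vbar : IsDedekindDomain.HeightOneSpectrum (NumberField.RingOfIntegers K)) (κ₁ κ₂ : Literature.NumberTheory.EllipticCurves.ZpExtension K p) (γ₁ γ₂ : Field.absoluteGaloisGroup K) [Fact (Literature.NumberTheory.EllipticCurves.ZpExtension.IsTopGeneratorPair κ₁ κ₂ γ₁ γ₂)] [NeZero (NumberField.discr K).natAbs] (N : ℕ) [NeZero N] (f : CuspForm (CongruenceSubgroup.Gamma0 N) 2), Literature.NumberTheory.EllipticCurves.ModularForms.IsNewformOf W f → (N : ℤ) = W.conductorNorm ℤ → Literature.NumberTheory.EllipticCurves.IsImaginaryQuadratic K → ((Ideal.span {(p : ℤ)}).primesOver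 (NumberField.RingOfIntegers K)).ncard = 2 → ((p : ℕ) : NumberField.RingOfIntegers K) ∈ v.asIdeal → ((p : ℕ) : NumberField.RingOfIntegers K) ∈ vbar.asIdeal → vbar ≠ v → (∀ (w : NumberField.InfinitePlace K) (k : NumberField.RingOfIntegers K), k ∈ v.asIdeal ↔ ‖ι.symm (w.embedding (k : K))‖ < 1) → IsCoprime (N : ℤ) (NumberField.discr K) → (∀ ℓ : ℕ, ℓ.Prime → ℓ ∣ N → ((Ideal.span {(ℓ : ℤ)}).primesOver (NumberField.RingOfIntegers K)).ncard = 2) → Odd (NumberField.discr K) → NumberField.discr K ≠ -3 → κ₁.IsCyclotomic → κ₂.IsAnticyclotomic → ∀ (Ω δ : ℂ) (Ωp : (Literature.NumberTheory.EllipticCurves.unrIntegers p)ˣ) (LK G : PowerSeries (PowerSeries (PadicComplexInt p))), Ω ≠ 0 → (δ ^ 2 = (NumberField.discr K : ℂ) ∨ δ ^ 2 = -(NumberField.discr K : ℂ)) → Literature.NumberTheory.EllipticCurves.IsKatzMeasure₂ ι v vbar ∅ κ₁ κ₂ γ₁⁻¹ γ₂⁻¹ 1 Ω δ ((Ωp :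 Literature.NumberTheory.EllipticCurves.unrIntegers p) : PadicComplex p) LK → Literature.NumberTheory.EllipticCurves.IsGreenbergLFunctionAnyRoot₂ ι v vbar κ₁ κ₂ γ₁⁻¹ γ₂⁻¹ f (NumberField.discr K).natAbs (NumberField.classNumber K) LK G → ∃ (ΩK : ℂ) (Ωp' : (Literature.NumberTheory.EllipticCurves.unrIntegers p)ˣ) (L : Literature.NumberTheory.EllipticCurves.UnrSeries p), ΩK ≠ 0 ∧ Literature.NumberTheory.EllipticCurves.IsBDPLFunction ι v κ₂ γ₂ f ΩK ((Ωp' : Literature.NumberTheory.EllipticCurves.unrIntegers p) : PadicComplex p) L ∧ ∀ (J₀ : Literature.NumberTheory.EllipticCurves.unrIntegers p →+* PadicComplexInt p), (∀ x : Literature.NumberTheory.EllipticCurves.unrIntegers p, ((J₀ x : PadicComplexInt p) : PadicComplex p) = (x : PadicComplex p)) → Ideal.span {Literature.NumberTheory.EllipticCurves.UnrSeries₂.minus G} = Ideal.span {PowerSeries.map J₀ L} := by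
  intro _ _ W _ _ p _ hp hgood hs K _ _ ι v vbar κ₁ κ₂ γ₁ γ₂ _ _ N _ f hf hN hK hsplit hv hvbar hvv hι hcop hHeeg
    hodd hne3 hκ₁ hκ₂ Ω δ Ωp LK G hΩ hδ hLK hG
  have hirr : (W.baseChange K).HasIrreducibleModPGaloisRep p :=
    Summit.BirchSwinnertonDyer.Rank1Residual.irrK_of_surj W p hs K hK.1
  -- a BDP frame at the good prime `p` (BCS25 Prop. 4.2.2 / Hsieh Thm. B)
  obtain ⟨ΩK, Ωp', L, hΩK, hL, -⟩ := h422e ι W K v κ₂ γ₂ hf (by omega) hgood hK hHeeg hsplit hodd hne3 hirr hv hι hκ₂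
    (isTopGenerator_of_pair (κ₁ := κ₁) (γ₁ := γ₁))
  refine ⟨ΩK, Ωp', L, hΩK, hL, fun J₀ hJ₀ ↦ ?_⟩
  by_cases hap : (p : ℤ) ∣ W.frobeniusTrace p
  · -- supersingular: `a_p = 0` (Hasse, `p ≥ 5`), `p ∤ N_E`; BSTW24 Prop. 6.27 (i)
    have ha0 : W.frobeniusTrace p = 0 := (W.natCast_dvd_frobeniusTrace_iff_eq_zero p hp hgood).mp hap
    have hpN : ¬ (p : ℤ) ∣ W.conductorNorm ℤ := by
      intro h
      exact not_dvd_conductorNorm_of_hasGoodReductionAtPrime W hgood (by exact_mod_cast h)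
    exact h627 ι W K v vbar κ₁ κ₂ γ₁ γ₂ hf hN hp hpN ha0 hK hsplit hv hvbar hvv hι hcop hHeeg hodd hne3 hκ₁ hκ₂
      Ω δ Ωp LK G hΩ hδ hLK hG ΩK Ωp' L hΩK hL J₀ hJ₀
  · -- ordinary: Yan–Zhu Prop. 3.14 (guarded)
    have hset : GreenbergSetting ι W N K v vbar κ₁ κ₂ :=
      ⟨hN, by omega, ⟨hgood, hap⟩, hK, hsplit, hv, hvbar, hvv, hι, hcop, hodd, hne3, hκ₁, hκ₂⟩
    exact h314 ι W K v vbar κ₁ κ₂ γ₁ γ₂ hf hset hHeeg Ω δ Ωp LK G hΩ hδ hLK hG ΩK Ωp' L hΩK hL J₀ hJ₀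

end Summit.BirchSwinnertonDyer.BirchSwinnertonDyer.Theorems.SignedBaseChangeAcDivMinusIsBDP

end
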